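import Summits.NavierStokesRegularity.NavierStokesRegularity.Theses.SymmetryModuliCount
import Literature.Analysis.FluidPDE.TypeIAncientMildClassical
import Literature.Analysis.FluidPDE.CurlFreeLiouville
import Literature.Analysis.FluidPDE.ConstantinDirectionDissipationCalculus
import Literature.Analysis.FluidPDE.Vorticity
import HarnessLib
import HarnessLib.Audit

/-!
# Line `vortex-stretching-wall` for crux `SymmetryModuliCount.LinearLiouvilleSeven`
# (stmt-NavierStokesRegularity-4054)

Planner's CHECKED SKELETON (planner-cruxplan-stmt-NavierStokesRegularity-4054-vortex-stretching-wa-0,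
2026-08-15; idea card `Cruxes/LinearLiouvilleSeven/Ideas/vortex-stretching-wall.md`, triage
`TRIAGE-r1-1.md`: pass).

## The crux and the frame

`LinearLiouvilleSeven` (LL7): around any `u` in the Type-I ancient class `𝒜_C` (jointly smooth on
`t < 0`, divergence free, KNSS-mild, `|u| ≤ C/√(−t)`; in the tree this class is LITERALLY
`Literature.Analysis.FluidPDE.IsTypeIAncientMild C u`, `isTypeIAncientMild_iff`), any seven
tempered classical solutions of the linearised system are dependent modulo slice constants.
Triage r1 (galilean-collapse, machine-checked there) established `LL7 ⇔ X := TypeIAncientLiouville`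
given KNSS gauge bounds; the only part of LL7 provable without proving `X` is the `u = 0` ANCHOR
(tempered ancient STOKES solutions are slice-constant, STUB 5). This line attacks `X` itself and
reaches LL7 through the anchor; the composition `LinearLiouvilleSeven_of` is kernel-checked below.

## The line (similarity variables; every object is an existing tree declaration)

For `u ∈ 𝒜_C` put `U = lerayOrbit u` (`U(s,y) = √(−t) u(t, √(−t) y)`, `t = −e^{−s}`),
`Ω = lerayVorticity u = curl U(s)` (`= (−t) ω`), `Θ = ‖Ω‖` (`= (−t)|ω|`, the card's `θ`),
`ξ = vorticityDirection (Ω s)`, and the ALIGNED STRETCHING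
`W(s,y) = ⟪DU(s,y) ξ, ξ⟫ − |Dξ(s,y)|²_F` (`= (−t)(ξ·Sξ − |∇ξ|²)`; the pressure never enters).

* STUB 1 `stub_simGradientBound` (KNSS 2009 Prop. 4.1, scale-invariant form; provable from the tree's
  window bounds + zoom invariance; S–M): `‖DU(s,y)‖ ≤ C₁` for all `s, y`.
* STUB 2 `stub_katoSimilarityIdentity` (Kato's identity on the tree's similarity vorticity equation
  `IsTypeIAncientMild.lerayVorticity_eq`; M): on `{Ω ≠ 0}`,
  `∂ₛΘ = ΔΘ − (y/2 + U)·∇Θ + (W − 1)Θ`.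
* STUB 3 `stub_certificateComparison` (the maximum-principle ENGINE; M–L): if `h ≥ 1` is a smooth
  "stretching certificate" — `∂ₛh + (y/2+U)·∇h − Δh ≥ (W − 1 + δ)h` on `{Ω ≠ 0}`, `δ > 0`,
  `|∇h| ≤ A(1+|y|)h` — then `Ω ≡ 0` (`Φ = e^{δs}Θ/h` is a bounded subsolution of a drift–heat operator
  with linearly growing drift on `{Ω ≠ 0}`, vanishing on `{Ω = 0}`; weak maximum principle on
  `[s₀,s₁] × ℝ³` with the barrier `(|y|²+K)e^{M(s−s₀)}`, then `s₀ → −∞` using `Θ ≤ √6 C₁`).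
* STUB 4 `stub_stretchingCertificate` (THE BET = transfer target `C⁺`, "the backward principal
  stretching exponent of every `u ∈ 𝒜_C` is `< 1`", in positive-supersolution form; hardest, open):
  every `u ∈ 𝒜_C` with `‖DU‖ ≤ C₁` admits such a certificate. Explicit instances already in hand
  (card + triage §B): `h = 1` needs `W ≤ 1 − δ` everywhere (the ε-wall); `h = exp(α|y|²)`,
  `0 < α < 1/4`, needs `W ≤ 1 − ε` only on the similarity ball `|y| ≤ R(ε, C, C₁)` (certificate
  Liouville / paraboloid localisation, the lead's first landable theorem via STUB 3).
* STUB 5 `stub_temperedStokesLiouville` (the anchor; M): tempered classical ancient solutions of the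
  Stokes system on `(−∞,0) × ℝ³` are spatially constant on every slice.
* STUB 6 `stub_gaussianCertificate` (provable now; M): for `ε > 0` an explicit `R(ε, C, C₁)` such that
  `W ≤ 1 − ε` on `{Ω ≠ 0, ‖y‖ ≤ R}` alone makes `h = exp(α‖y‖²)` a certificate (OU confinement absorbs
  any bounded stretching outside the ball). Not a hypothesis of `LinearLiouvilleSeven_of`; with STUBS
  2–3 it gives the side composition `stretchingCertificateLiouville_of` = the card's First Lemma
  (paraboloid-localised sub-critical stretching ⇒ `u ≡ 0`), kernel-checked below.

Glue PROVED here (no `sorry`): `Ω ≡ 0 ⇒ curl u ≡ 0` (`curl_lerayOrbit`), `⇒ u(t,·)` constant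
(`eq_of_curl_eq_zero_of_isDivFree_of_bounded`), `⇒ u ≡ 0` (`IsTypeIAncientMild.eq_zero_of_slice_const`,
the KNSS gauge), i.e. `X`; and `X ∧ STUB 5 ⇒ LL7` (around `u = 0` the linearised system IS the Stokes
system; take `c = (1,…,1)`). Compositions: `LinearLiouvilleSeven_of : STUB1 → STUB2 → STUB3 → STUB4 →
STUB5 → LinearLiouvilleSeven` (the crux BY NAME) and `LinearLiouvilleSeven_skeleton`.

DISPROOF USED: none — no `Disproof.lean` exists for this crux (`ledger crux ls`, 2026-08-15T23:5xZ;
payload `disproof_path` absent on this hub). The one structural obstruction on record (galilean-collapse,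
TRIAGE §A.5: any proof of LL7 must prove `X`, i.e. must use that `u` solves Navier–Stokes) is honoured:
STUBS 2–4 act on `u`'s own vorticity equation, never on the linear operator `L_u`.
-/

noncomputable section

open MeasureTheory Set Function Filter
open scoped InnerProductSpace RealInnerProductSpace Laplacian ContDiff

namespace Summit.NavierStokesRegularity.NavierStokesRegularity.Cruxes.LinearLiouvilleSeven.VortexStretchingWall

set_option linter.unusedVariables false
set_option linter.dupNamespace false

open Literature.Analysis.FluidPDE
open Summit.NavierStokesRegularity.NavierStokesRegularity.Theses.SymmetryModuliCount (LinearLiouvilleSeven)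

local notation "ℝ³" => EuclideanSpace ℝ (Fin 3)

/-! ### The stub statements

Each stub's statement is the named proposition `Statement.<stub name>` (same short name as the
registered stub theorem, so that the hypotheses of `LinearLiouvilleSeven_of` are the stubs BY NAME
for the skeleton audit); only tree declarations occur inside them. -/

namespace Statement

/-- **STUB 1 — scale-invariant gradient bound in similarity variables (KNSS 2009, Prop. 4.1 /
(4.6) with `k = 1`; provable now, size S–M).** For `u ∈ 𝒜_C` the similarity profile
`U = lerayOrbit u` has a bounded gradient: `‖D U(s)(y)‖ ≤ C₁` for all `s ∈ ℝ`, `y ∈ ℝ³`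
(equivalently `|∇u(t,x)| ≤ C₁/(−t)`, since `D_yU(s,y) = (−t) D_xu(t,x)`,
`fderiv_lerayOrbit_eq_lerayOrbitVorticity`). Route: the tree's window bound
`Theorems.exists_norm_iteratedFDeriv_le_of_typeI` (k = 1, window `[−1,−1/2)`) transported to every
`t < 0` by the zoom invariance of the class (`Theorems.isTypeIAncientMild_zoom`), or directly
`IsKNSSDriftMild.exists_gradient_bound`. [cite: KochNadirashviliSereginSverak2009, Prop. 4.1 (4.6)] -/
def stub_simGradientBound : Prop :=
  ∀ (C : ℝ) (u : ℝ → ℝ³ → ℝ³), IsTypeIAncientMild C u →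
    ∃ C₁ : ℝ, ∀ (s : ℝ) (y : ℝ³), ‖fderiv ℝ (lerayOrbit u s) y‖ ≤ C₁

/-- **STUB 2 — Kato's identity for the similarity vorticity modulus (size M).** For `u ∈ 𝒜_C`,
wherever `Ω(s,y) ≠ 0` the modulus `Θ = ‖Ω‖` (`Ω = lerayVorticity u`, smooth there) satisfies
`∂ₛΘ = ΔΘ − (y/2 + U)·∇Θ + (W − 1)Θ`, `W = ⟪DU ξ, ξ⟫ − |Dξ|²_F`, `ξ = Ω/‖Ω‖`: take the inner
product of the tree's similarity vorticity equation
`∂ₛΩ + Ω + ½(y·∇)Ω + (U·∇)Ω = (Ω·∇)U + ΔΩ` (`IsTypeIAncientMild.lerayVorticity_eq`, all `s`) with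
`ξ`, and use Kato's identity `ΔΘ = ⟪ξ, ΔΩ⟫ + Θ|Dξ|²_F` (tree:
`norm_mul_frobeniusNormSq_fderiv_vorticityDirection`, `hasFDerivAt_vorticityDirection`); the
antisymmetric part of `DU` drops out of `⟪DU ξ, ξ⟫`, and the pressure never appears.
[cite: ConstantinFefferman1993, §1 (stretching formula)] [cite: Constantin1990, (2.9)] -/
def stub_katoSimilarityIdentity : Prop :=
  ∀ (C : ℝ) (u : ℝ → ℝ³ → ℝ³), IsTypeIAncientMild C u →
    ∀ (s : ℝ) (y : ℝ³), lerayVorticity u s y ≠ 0 →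
      timeDerivWithin Set.univ (fun s y => ‖lerayVorticity u s y‖) s y =
        (Δ (fun y => ‖lerayVorticity u s y‖)) y
          - fderiv ℝ (fun y => ‖lerayVorticity u s y‖) y ((1 / 2 : ℝ) • y + lerayOrbit u s y)
          + (⟪fderiv ℝ (lerayOrbit u s) y (vorticityDirection (lerayVorticity u s) y),
                vorticityDirection (lerayVorticity u s) y⟫_ℝ
              - frobeniusNormSq (fderiv ℝ (vorticityDirection (lerayVorticity u s)) y) - 1)
            * ‖lerayVorticity u s y‖

/-- **STUB 3 — the certificate comparison principle (the engine; size M–L).** Let `u ∈ 𝒜_C` with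
`‖DU‖ ≤ C₁`, and suppose the Kato identity of STUB 2 holds for `u`. If `h : ℝ → ℝ³ → ℝ` is jointly
smooth, `h ≥ 1`, `‖∇h(s,y)‖ ≤ A(1 + ‖y‖) h(s,y)`, and `h` is a STRETCHING CERTIFICATE with rate
`δ > 0` — a supersolution `∂ₛh + (y/2 + U)·∇h − Δh ≥ (W − 1 + δ) h` wherever `Ω ≠ 0` — then
`Ω ≡ 0`. Proof: `Ψ = Θ/h` satisfies `∂ₛΨ ≤ ΔΨ − (y/2 + U − 2∇h/h)·∇Ψ − δΨ` on `{Ω ≠ 0}`,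
`0 ≤ Ψ ≤ Θ ≤ √6 C₁` (`norm_curl_sq_le_two_mul_frobeniusNormSq`), `Ψ = 0` on `{Ω = 0}`; the weak
maximum principle for `Φ = e^{δs}Ψ` on `[s₀,s₁] × ℝ³` (drift of linear growth: `|U| ≤ C`, barrier
`(|y|² + K)e^{M(s−s₀)}`; at a positive maximum `Ω ≠ 0` so `Φ` is smooth there — cf. the tree's
`weak_max_principle` (SwirlMaximumPrinciple) and `isConst_of_driftOp_nonneg` (TsaiMaximumPrinciple,
OU drift with Gaussian growth)) gives `sup Ψ(s₁) ≤ e^{−δ(s₁−s₀)} √6 C₁ → 0` as `s₀ → −∞` (ANCIENT).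
No compactness, no strong maximum principle, no Harnack inequality is needed.
[cite: Lieberman1996, Ch. II Lemma 2.1 and Thm. 2.4] [cite: Tsai1998, Lemma 5.1] -/
def stub_certificateComparison : Prop :=
  ∀ (C C₁ δ A : ℝ) (u : ℝ → ℝ³ → ℝ³) (h : ℝ → ℝ³ → ℝ), IsTypeIAncientMild C u →
    (∀ (s : ℝ) (y : ℝ³), ‖fderiv ℝ (lerayOrbit u s) y‖ ≤ C₁) →
    (∀ (s : ℝ) (y : ℝ³), lerayVorticity u s y ≠ 0 →
      timeDerivWithin Set.univ (fun s y => ‖lerayVorticity u s y‖) s y =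
        (Δ (fun y => ‖lerayVorticity u s y‖)) y
          - fderiv ℝ (fun y => ‖lerayVorticity u s y‖) y ((1 / 2 : ℝ) • y + lerayOrbit u s y)
          + (⟪fderiv ℝ (lerayOrbit u s) y (vorticityDirection (lerayVorticity u s) y),
                vorticityDirection (lerayVorticity u s) y⟫_ℝ
              - frobeniusNormSq (fderiv ℝ (vorticityDirection (lerayVorticity u s)) y) - 1)
            * ‖lerayVorticity u s y‖) →
    0 < δ →
    ContDiff ℝ (⊤ : ℕ∞) (Function.uncurry h) →
    (∀ (s : ℝ) (y : ℝ³), 1 ≤ h s y) →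
    (∀ (s : ℝ) (y : ℝ³), ‖fderiv ℝ (h s) y‖ ≤ A * (1 + ‖y‖) * h s y) →
    (∀ (s : ℝ) (y : ℝ³), lerayVorticity u s y ≠ 0 →
      (⟪fderiv ℝ (lerayOrbit u s) y (vorticityDirection (lerayVorticity u s) y),
          vorticityDirection (lerayVorticity u s) y⟫_ℝ
        - frobeniusNormSq (fderiv ℝ (vorticityDirection (lerayVorticity u s)) y) - 1 + δ) * h s y ≤
      timeDerivWithin Set.univ h s y + fderiv ℝ (h s) y ((1 / 2 : ℝ) • y + lerayOrbit u s y)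
        - (Δ (h s)) y) →
    ∀ (s : ℝ) (y : ℝ³), lerayVorticity u s y = 0

/-- **STUB 4 — THE BET: every Type-I ancient mild solution admits a stretching certificate
(transfer target `C⁺`; hardest, OPEN).** For `u ∈ 𝒜_C` with `‖DU‖ ≤ C₁` there are `δ > 0`, `A`
and a jointly smooth `h ≥ 1` with `‖∇h‖ ≤ A(1+‖y‖)h` which is a supersolution
`∂ₛh + (y/2 + U)·∇h − Δh ≥ (W − 1 + δ)h` on `{Ω ≠ 0}`. This is the positive-supersolution
(Agmon–Allegretto–Piepenbrink / Berestycki–Nirenberg–Varadhan) form of "the backward principal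
exponent `γ(u)` of `∂ₛ − [Δ − (y/2+U)·∇ + W]` is `< 1`": Liouville as an OCCUPATION inequality for
the self-similar Ornstein–Uhlenbeck particle rather than a pointwise one. What is in hand: with
`h = exp(α|y|²)`, `0 < α < 1/4`, `Δh − (y/2+U)·∇h = [6α − α(1−4α)|y|² − 2αU·y]h` and `W ≤ C₁`, so the
inequality holds automatically for `|y| ≥ R(α, δ, C, C₁)` (OU confinement) and the bet reduces to
sub-critical ALIGNED stretching `W ≤ 1 − ε` on ONE similarity ball (card; triage §B items 3–4);
`h = 1` is the closed wall. Why it might fail: a nonzero backward DSS profile would have `γ ≥ 1`;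
nothing in hand caps the Gaussian-window occupation of `W` for large `C` — the Navier–Stokes input
(`Ω = curl U`, the good sign of `−|∇ξ|²`, the similarity local energy inequality) must enter here.
Equivalent to `X` like every Liouville certificate (vacuous at `u = 0`); the content is structural.
[cite: KochNadirashviliSereginSverak2009, Thm. 5.2-5.3 (the h = r and swirl certificates)]
[cite: BradshawTsai2017CPDE, §5 Open Problem 5.1] -/
def stub_stretchingCertificate : Prop :=
  ∀ (C C₁ : ℝ) (u : ℝ → ℝ³ → ℝ³), IsTypeIAncientMild C u →
    (∀ (s : ℝ) (y : ℝ³), ‖fderiv ℝ (lerayOrbit u s) y‖ ≤ C₁) →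
    ∃ (δ A : ℝ) (h : ℝ → ℝ³ → ℝ), 0 < δ ∧ ContDiff ℝ (⊤ : ℕ∞) (Function.uncurry h) ∧
      (∀ (s : ℝ) (y : ℝ³), 1 ≤ h s y) ∧
      (∀ (s : ℝ) (y : ℝ³), ‖fderiv ℝ (h s) y‖ ≤ A * (1 + ‖y‖) * h s y) ∧
      ∀ (s : ℝ) (y : ℝ³), lerayVorticity u s y ≠ 0 →
        (⟪fderiv ℝ (lerayOrbit u s) y (vorticityDirection (lerayVorticity u s) y),
            vorticityDirection (lerayVorticity u s) y⟫_ℝ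
          - frobeniusNormSq (fderiv ℝ (vorticityDirection (lerayVorticity u s)) y) - 1 + δ) * h s y ≤
        timeDerivWithin Set.univ h s y + fderiv ℝ (h s) y ((1 / 2 : ℝ) • y + lerayOrbit u s y)
          - (Δ (h s)) y

/-- **STUB 5 — the `u = 0` anchor: Liouville for tempered ancient Stokes solutions (size M).** A
classical solution `(v, q)` of the Stokes system `∂ₜv = Δv − ∇q`, `div v = 0` on `(−∞,0) × ℝ³`,
jointly smooth, with the tempered growth of the crux (`|v| ≤ K(1/√(−t) + (1+|x|)/(−t))`,
`|q| ≤ K(1/(−t) + (1+|x|)/(−t)^{3/2})`), is spatially constant on every slice. Proof (triage §A.4,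
verified there): `Δq = 0` with linear growth ⇒ `q = α(t) + γ(t)·x`, `|γ(t)| ≤ K(−t)^{−3/2}`;
`w = v + ∫_{−∞}^t γ` is an ancient caloric field with `|w| ≲ 1/√(−t) + (1+|x|)/(−t)`; Tychonoff
uniqueness `w(t) = e^{(t−s)Δ}w(s)` and `s → −∞` give `w ≡ 0`, i.e. `v(t,·) = −∫_{−∞}^t γ`. Tree
engines: harmonic Liouville (`HarmonicLiouvilleLp`, `harmonicOnNhd_of_laplacian_eq_zero`), ancient
caloric growth lemmas (`KNSSLemma31Caloric/Liouville`), `heatFlow`. [cite: KochNadirashviliSereginSverak2009, Lemma 3.1 and Remark 6.1] -/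
def stub_temperedStokesLiouville : Prop :=
  ∀ (v : ℝ → ℝ³ → ℝ³) (q : ℝ → ℝ³ → ℝ),
    ContDiffOn ℝ (⊤ : ℕ∞) (Function.uncurry v) (Set.Iio 0 ×ˢ Set.univ) →
    ContDiffOn ℝ (⊤ : ℕ∞) (Function.uncurry q) (Set.Iio 0 ×ˢ Set.univ) →
    (∃ K : ℝ, ∀ t < 0, ∀ x, ‖v t x‖ ≤ K / Real.sqrt (-t) + K * (1 + ‖x‖) / (-t) ∧
        |q t x| ≤ K / (-t) + K * (1 + ‖x‖) / Real.sqrt (-t) ^ 3) →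
    (∀ t < 0, VectorCalculus.IsDivFree (v t)) →
    (∀ t < 0, ∀ x, timeDeriv v t x = Laplacian.laplacian (v t) x - gradient (q t) x) →
    ∀ t < 0, ∃ b : ℝ³, ∀ x, v t x = b

/-- **STUB 6 — the Gaussian certificate: OU confinement absorbs every bounded stretching outside ONE
similarity ball (the card's lever in its first non-pointwise rung; provable now, size M).** For
`ε > 0` and constants `C, C₁` there is an explicit radius `R = R(ε, C, C₁)` such that for every
`u ∈ 𝒜_C` with `‖DU‖ ≤ C₁`, sub-critical aligned stretching `W ≤ 1 − ε` on
`{Ω ≠ 0} ∩ {‖y‖ ≤ R}` ALONE produces a stretching certificate in the sense of STUBS 3–4. Witness: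
`h(s,y) = exp(α‖y‖²)`, `0 < α < 1/4`, `δ = ε/3`, `A = 2α`: `∂ₛh = 0` and
`(y/2 + U)·∇h − Δh = [α(1−4α)‖y‖² + 2αU·y − 6α]h` (triage §B item 3, recomputed), while
`W ≤ ⟪DUξ,ξ⟫ ≤ ‖DU‖ ≤ C₁` and `|U| ≤ C` (`|U(s,y)| = √(−t)|u| ≤ C`); hence the supersolution
inequality `α(1−4α)‖y‖² + 2αU·y − 6α ≥ W − 1 + δ` holds for `‖y‖ ≥ R₀(α,δ,C,C₁)` (positive root of
`α(1−4α)r² − 2αCr − 6α = C₁ − 1 + δ`) whatever `W` is, and for `‖y‖ ≤ R₀` as soon as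
`ε ≥ δ + 6α + 2αC R₀` — true for `α` small since `αR₀(α) = O(√α)`; take `R = R₀`. [cite: KochNadirashviliSereginSverak2009, §5 (the h = r certificate of Thm. 5.2, analogue)] -/
def stub_gaussianCertificate : Prop :=
  ∀ (ε C C₁ : ℝ), 0 < ε → ∃ R : ℝ, 0 < R ∧
    ∀ (u : ℝ → ℝ³ → ℝ³), IsTypeIAncientMild C u →
      (∀ (s : ℝ) (y : ℝ³), ‖fderiv ℝ (lerayOrbit u s) y‖ ≤ C₁) →
      (∀ (s : ℝ) (y : ℝ³), lerayVorticity u s y ≠ 0 → ‖y‖ ≤ R →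
        ⟪fderiv ℝ (lerayOrbit u s) y (vorticityDirection (lerayVorticity u s) y),
            vorticityDirection (lerayVorticity u s) y⟫_ℝ
          - frobeniusNormSq (fderiv ℝ (vorticityDirection (lerayVorticity u s)) y) ≤ 1 - ε) →
      ∃ (δ A : ℝ) (h : ℝ → ℝ³ → ℝ), 0 < δ ∧ ContDiff ℝ (⊤ : ℕ∞) (Function.uncurry h) ∧
        (∀ (s : ℝ) (y : ℝ³), 1 ≤ h s y) ∧
        (∀ (s : ℝ) (y : ℝ³), ‖fderiv ℝ (h s) y‖ ≤ A * (1 + ‖y‖) * h s y) ∧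
        ∀ (s : ℝ) (y : ℝ³), lerayVorticity u s y ≠ 0 →
          (⟪fderiv ℝ (lerayOrbit u s) y (vorticityDirection (lerayVorticity u s) y),
              vorticityDirection (lerayVorticity u s) y⟫_ℝ
            - frobeniusNormSq (fderiv ℝ (vorticityDirection (lerayVorticity u s)) y) - 1 + δ) * h s y ≤
          timeDerivWithin Set.univ h s y + fderiv ℝ (h s) y ((1 / 2 : ℝ) • y + lerayOrbit u s y)
            - (Δ (h s)) y

end Statement

/-! ### Registered stubs -/

/-- STUB 1: scale-invariant gradient bound `‖DU‖ ≤ C₁` (KNSS Prop. 4.1; provable from the tree). -/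
theorem stub_simGradientBound : Statement.stub_simGradientBound := by
  sorry

/-- STUB 2: Kato's identity for `Θ = ‖Ω‖` on the similarity vorticity equation. -/
theorem stub_katoSimilarityIdentity : Statement.stub_katoSimilarityIdentity := by
  sorry

/-- STUB 3: a stretching certificate forces `Ω ≡ 0` (weak maximum principle, `s₀ → −∞`). -/
theorem stub_certificateComparison : Statement.stub_certificateComparison := by
  sorry

/-- STUB 4 (hardest, the bet `C⁺`): every `u ∈ 𝒜_C` admits a stretching certificate. -/
theorem stub_stretchingCertificate : Statement.stub_stretchingCertificate := by
  sorry

/-- STUB 5: tempered ancient Stokes solutions are slice-constant (the `u = 0` anchor). -/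
theorem stub_temperedStokesLiouville : Statement.stub_temperedStokesLiouville := by
  sorry

/-- STUB 6: the Gaussian certificate `exp(α‖y‖²)` — sub-critical aligned stretching on one
similarity ball already yields a certificate (feeds the side composition
`stretchingCertificateLiouville_of`, the card's First Lemma; not a hypothesis of
`LinearLiouvilleSeven_of`). -/
theorem stub_gaussianCertificate : Statement.stub_gaussianCertificate := by
  sorry

/-! ### Proved glue: `Ω ≡ 0 ⇒ u ≡ 0` in the KNSS gauge -/

/-- If the similarity vorticity vanishes identically then so does the physical vorticity:
`curl U(s) = e^{−s} • curl u(t)(√(−t)·)` (`curl_lerayOrbit`) read at `s = −log(−t)`. [folklore] -/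
theorem curl_eq_zero_of_lerayVorticity_eq_zero {u : ℝ → ℝ³ → ℝ³}
    (hΩ : ∀ (s : ℝ) (y : ℝ³), lerayVorticity u s y = 0) {t : ℝ} (ht : t < 0) (x : ℝ³) :
    curl (u t) x = 0 := by
  have hnt : 0 < -t := neg_pos.2 ht
  set s : ℝ := -Real.log (-t) with hs
  have h1 : Real.exp (-s) = -t := by rw [hs, neg_neg, Real.exp_log hnt]
  have h2 : (0 : ℝ) < Real.exp (-s / 2) := Real.exp_pos _
  have key := hΩ s ((Real.exp (-s / 2))⁻¹ • x)
  rw [lerayVorticity_apply, curl_lerayOrbit, smul_smul, mul_inv_cancel₀ h2.ne', one_smul, h1,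
    neg_neg] at key
  rcases smul_eq_zero.1 key with h0 | h0
  · exact absurd h0 hnt.ne'
  · exact h0

/-- **`X` for one field from `Ω ≡ 0`**: an element of `𝒜_C` with vanishing similarity vorticity is
zero — each slice is curl-free, divergence-free, bounded and `C²`, hence constant
(`eq_of_curl_eq_zero_of_isDivFree_of_bounded`, KNSS 2009 Lemma 3.1), and the KNSS gauge kills
slice-constant elements (`IsTypeIAncientMild.eq_zero_of_slice_const`, Remark 6.1). [cite: KochNadirashviliSereginSverak2009, Lemma 3.1 and Remark 6.1] -/
theorem eq_zero_of_lerayVorticity_eq_zero {C : ℝ} {u : ℝ → ℝ³ → ℝ³} (hu : IsTypeIAncientMild C u)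
    (hΩ : ∀ (s : ℝ) (y : ℝ³), lerayVorticity u s y = 0) {t : ℝ} (ht : t < 0) (x : ℝ³) :
    u t x = 0 := by
  have hub : ∀ t < 0, ∀ x, u t x = u t 0 := by
    intro t ht x
    have h2 : ContDiff ℝ 2 (u t) := (hu.contDiff_slice ht).of_le two_le_infty
    exact eq_of_curl_eq_zero_of_isDivFree_of_bounded h2
      (fun y => curl_eq_zero_of_lerayVorticity_eq_zero hΩ ht y) (hu.isDivFree ht)
      (fun y => hu.norm_le ht y) x 0
  exact hu.eq_zero_of_slice_const (b := fun t => u t 0) hub ht x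

/-- **`X` (TypeIAncientLiouville, over the tree class) from STUBS 1–4** (pure logic over the four
stub statements and `eq_zero_of_lerayVorticity_eq_zero`). [folklore] -/
theorem typeIAncientLiouville_of_stubs
    (h₁ : Statement.stub_simGradientBound) (h₂ : Statement.stub_katoSimilarityIdentity)
    (h₃ : Statement.stub_certificateComparison) (h₄ : Statement.stub_stretchingCertificate)
    {C : ℝ} {u : ℝ → ℝ³ → ℝ³} (hu : IsTypeIAncientMild C u) {t : ℝ} (ht : t < 0) (x : ℝ³) :
    u t x = 0 := by
  obtain ⟨C₁, hC₁⟩ := h₁ C u hu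
  obtain ⟨δ, A, h, hδ, hsm, hone, hgrad, hcert⟩ := h₄ C C₁ u hu hC₁
  have hΩ : ∀ (s : ℝ) (y : ℝ³), lerayVorticity u s y = 0 :=
    h₃ C C₁ δ A u h hu hC₁ (h₂ C u hu) hδ hsm hone hgrad hcert
  exact eq_zero_of_lerayVorticity_eq_zero hu hΩ ht x

/-- **CERTIFICATE LIOUVILLE (the card's First Lemma `StretchingCertificateLiouville`, over the tree
class and with the gradient bound made an explicit hypothesis as triage r1-1 asked) from STUBS 2, 3, 6**
— kernel-checked side composition, the lead's first landable theorem of the line: for every `ε > 0`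
there is `R = R(ε, C, C₁)` such that an element of `𝒜_C` with `‖DU‖ ≤ C₁` whose aligned stretching is
sub-critical, `W ≤ 1 − ε`, on the single similarity ball `{Ω ≠ 0, ‖y‖ ≤ R}` (= the backward
paraboloid `|x| ≤ R√(−t)`) vanishes identically. [cite: KochNadirashviliSereginSverak2009, §5] -/
theorem stretchingCertificateLiouville_of (h₂ : Statement.stub_katoSimilarityIdentity)
    (h₃ : Statement.stub_certificateComparison) (h₆ : Statement.stub_gaussianCertificate)
    (ε C C₁ : ℝ) (hε : 0 < ε) :
    ∃ R : ℝ, 0 < R ∧ ∀ (u : ℝ → ℝ³ → ℝ³), IsTypeIAncientMild C u →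
      (∀ (s : ℝ) (y : ℝ³), ‖fderiv ℝ (lerayOrbit u s) y‖ ≤ C₁) →
      (∀ (s : ℝ) (y : ℝ³), lerayVorticity u s y ≠ 0 → ‖y‖ ≤ R →
        ⟪fderiv ℝ (lerayOrbit u s) y (vorticityDirection (lerayVorticity u s) y),
            vorticityDirection (lerayVorticity u s) y⟫_ℝ
          - frobeniusNormSq (fderiv ℝ (vorticityDirection (lerayVorticity u s)) y) ≤ 1 - ε) →
      ∀ t < 0, ∀ x, u t x = 0 := by
  obtain ⟨R, hR, hcert⟩ := h₆ ε C C₁ hε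
  refine ⟨R, hR, fun u hu hC₁ hW t ht x => ?_⟩
  obtain ⟨δ, A, h, hδ, hsm, hone, hgrad, hsuper⟩ := hcert u hu hC₁ hW
  have hΩ : ∀ (s : ℝ) (y : ℝ³), lerayVorticity u s y = 0 :=
    h₃ C C₁ δ A u h hu hC₁ (h₂ C u hu) hδ hsm hone hgrad hsuper
  exact eq_zero_of_lerayVorticity_eq_zero hu hΩ ht x

/-! ### Proved glue: the anchor turns `X` into the crux -/

/-- **LL7 from `X` and the Stokes anchor.** Around an element of `𝒜_C` — which by `X` is `u ≡ 0` on
`t < 0` — the linearised system `∂ₜv + (u·∇)v + (v·∇)u = Δv − ∇q` is the Stokes system, so by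
STUB 5 each tempered `vᵢ` is slice-constant and `c = (1,…,1)` is a nontrivial slice-constant
combination. [folklore] -/
theorem linearLiouvilleSeven_of_liouville (h₅ : Statement.stub_temperedStokesLiouville)
    (hX : ∀ (C : ℝ) (u : ℝ → ℝ³ → ℝ³), IsTypeIAncientMild C u → ∀ t < 0, ∀ x, u t x = 0) :
    LinearLiouvilleSeven := by
  intro C u hu v q hvq
  have hA : IsTypeIAncientMild C u := isTypeIAncientMild_iff.2 hu
  have h0 : ∀ t < 0, ∀ x, u t x = 0 := hX C u hA
  refine ⟨fun _ => 1, ?_, ?_⟩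
  · intro hc
    have h10 := congrFun hc 0
    simp at h10
  · intro t ht
    have hb : ∀ i, ∃ b : ℝ³, ∀ x, v i t x = b := by
      intro i
      obtain ⟨hv1, hq1, hK, hdiv, heq⟩ := hvq i
      refine h₅ (v i) (q i) hv1 hq1 hK hdiv ?_ t ht
      intro t' ht' x
      have e := heq t' ht' x
      have hu0 : u t' = fun _ => (0 : ℝ³) := funext (h0 t' ht')
      rw [hu0] at e
      simpa [convect] using e
    choose b hb using hb
    exact ⟨∑ i, b i, fun x => by simp [hb]⟩

/-! ### The composition: the crux from the five stubs, BY NAME -/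

/-- **`LinearLiouvilleSeven` from the five stubs** (kernel-checked composition, no `sorry` here):
STUBS 1–4 give `X` over the tree class (`typeIAncientLiouville_of_stubs`), STUB 5 anchors it into
the crux (`linearLiouvilleSeven_of_liouville`). -/
theorem LinearLiouvilleSeven_of :
    Statement.stub_simGradientBound → Statement.stub_katoSimilarityIdentity →
      Statement.stub_certificateComparison → Statement.stub_stretchingCertificate →
        Statement.stub_temperedStokesLiouville →
          Summit.NavierStokesRegularity.NavierStokesRegularity.Theses.SymmetryModuliCount.LinearLiouvilleSeven := by
  intro h₁ h₂ h₃ h₄ h₅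
  exact linearLiouvilleSeven_of_liouville h₅
    (fun C u hu t ht x => typeIAncientLiouville_of_stubs h₁ h₂ h₃ h₄ hu ht x)

/-- The crux modulo the registered stubs. -/
theorem LinearLiouvilleSeven_skeleton :
    Summit.NavierStokesRegularity.NavierStokesRegularity.Theses.SymmetryModuliCount.LinearLiouvilleSeven :=
  LinearLiouvilleSeven_of stub_simGradientBound stub_katoSimilarityIdentity stub_certificateComparison
    stub_stretchingCertificate stub_temperedStokesLiouville

end Summit.NavierStokesRegularity.NavierStokesRegularity.Cruxes.LinearLiouvilleSeven.VortexStretchingWall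

end
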